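import Literature.AlgebraicGeometry.ShimuraVarieties.BallQuotientHodgeClasses
import Literature.AlgebraicGeometry.HodgeTheory.SupportedClassesRationalProofs
import Literature.AlgebraicGeometry.HodgeTheory.LefschetzOneOne
import Literature.AlgebraicGeometry.HodgeTheory.HardLefschetzNFold
import HarnessLib

/-!
# Cor. 62 of Bergeron–Millson–Moeglin in the degenerate range `a + b ≤ 1` (proof file)

Family `hodge`, layer `Literature/AlgebraicGeometry/ShimuraVarieties`. Proof file (theorems only)
for `BallQuotientHodgeClasses`, concerning its named fact `bmm2016_hodgePQ_definedOverQ`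
(BMM, *The Hodge conjecture and arithmetic quotients of complex balls*, Acta Math. 216 (2016) =
arXiv:1306.1515v2, Part 2 §1.9 Cor. 62 / Introduction §1.2 Remark 3: on a compact arithmetic
quotient `S = Γ \ 𝔹ᵖ`, each `H^{a,b}(S, ℂ) ⊕ H^{b,a}(S, ℂ)` with `3(a+b) + |a-b| < 2(p+1)` is
defined over `ℚ`).

**The fact is NOT discharged here.** What this file proves, unconditionally, is the part of its
rendering that carries no automorphic content:

* `hodgePQ_sup_hodgePQ_eq_top_of_add_le_one` — in any Hodge model `A` and any degree
  `k = a + b ≤ 1`, `H^{a,b} ⊔ H^{b,a} = Hᵏ(X^an; ℂ)`: the Hodge decomposition of the model (field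
  `HodgeModel.isInternal_hodgePQ`, Voisin I Thm. 6.18) is indexed by the antidiagonal of `k`, which
  for `k ≤ 1` is `{(a,b), (b,a)}`.
* `bmm2016_hodgePQ_definedOverQ_of_add_le_one` — hence for `X` smooth projective and `a + b ≤ 1`
  the conclusion of the fact holds for EVERY class (the Hodge-type condition is vacuous on both
  sides and the statement is "`Hᵏ(X(ℂ); ℂ)` is spanned by rational classes", the tree's proved
  `span_isRationalClass_eq_top_of_isSmoothProjective_holds`, Voisin I §7.1.1).
* `bmm2016_hodgePQ_definedOverQ_of_le_two` — the fact's statement for ball quotients of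
  dimension `p ≤ 2`: there the range `3(a+b) + |a-b| < 2(p+1) ≤ 6` forces `a + b ≤ 1`. (BMM's
  Remark after Cor. 62 — `H^{1,1} ⊂ H²` is NOT defined over `ℚ` for `p = 2`, Blasius–Rogawski — is
  about `(a,b) = (1,1)`, outside the range for `p = 2`; consistent.)
* `bmm2016_hodgePQ_definedOverQ_of_two_le`, `bmm2016_hodgePQ_definedOverQ_iff_two_le` — the
  reduction: the fact follows from, indeed is equivalent to, its instances with `3 ≤ p` and
  `2 ≤ a + b`.
* `bmm2016_hodgePQ_definedOverQ.mem_span_rational_nn` — the diagonal case in the layer's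
  `∃`-over-models spelling (`IsOfHodgeType`), general-`n` form of the sibling file's
  `mem_span_rational_oneOne`.
* `bmm2016_hodgePQ_definedOverQ.hodgeOneOne_mem_algebraicClasses` — a consequence worth naming:
  the fact together with Lefschetz' theorem on `(1,1)`-classes (named fact
  `lefschetzOneOne_rational`) gives, for `p > 2`, that EVERY class of Hodge type `(1,1)` on a
  compact ball quotient is a complex combination of divisor classes (`H^{1,1} ⊆ NS ⊗ ℂ`; BMM's
  Remark after Cor. 62 with Voisin I Thm. 11.30). Conditional on both facts.
* `bmm2016_hodgePQ_definedOverQ.hodgeTypeNN_mem_algebraicClasses` — likewise with Cor. 2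
  (`bmm2016_hodge_offMiddleThird`) in place of Lefschetz: for `3n ≤ p` every class of Hodge type
  `(n,n)` in `H²ⁿ(X(ℂ); ℂ)` lies in `algebraicClasses X n`; and
  `…hodgeTypeNN_mem_algebraicClasses_of_hardLefschetz`: the same for `3n ≤ p ∨ 2p ≤ 3n` given a
  hard Lefschetz datum `HardLefschetzNFold p X` (the upper third is the hard-Lefschetz transport of
  the lower, as in BMM §1.2). Conditional on both facts.
* `bmm2016_hodgePQ_definedOverQ.mem_supportedClasses_min` — with Thm. 1
  (`bmm2016_generalizedHodge_lowDegree`): in the range of Cor. 62 the whole complex piece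
  `H^{a,b} ⊔ H^{b,a}` lies in `supportedClasses X (a+b) (min a b)` (the range of Cor. 62 implies
  that of Thm. 1 with `c = min(a,b)`). Conditional on both facts.

**Why the rest is not proved (triage XL).** The remaining instances (`p ≥ 3`, `a + b ≥ 2`, first
case `H^{1,1} ⊂ H²` of a ball quotient threefold) are the content of Cor. 62, obtained in BMM from
Thm. 61: Matsushima's decomposition `H•(S(K), ℂ) = ⊕_{π_f} H•(π_f, ℂ) ⊗ π_f^K` (Part 2 §§1.6–1.8),
the Vogan–Zuckerman classification of cohomological representations `A(b×q, a×q)` of `U(p,q)`,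
the rationality of the Hecke-isotypic pieces `W([π_f])^K` (algebraic correspondences), and — the
deep half, Part 3 — that in the range `3(a+b) + |a-b| < 2m` every contributing `π` is a global theta
lift from a smaller unitary group, via Arthur's endoscopic classification for unitary groups (Mok;
inner forms by BMM App. A; resting on the stabilisation of the twisted trace formula
[cite: MoeglinWaldspurger2016, Vol. 1–2]). None of these theories is in Mathlib or in the tree.
[cite: BergeronMillsonMoeglin2016Balls, Part 2 §1.9 Thm. 61, Cor. 62 and Remark; §1.2 Remark 3]

**Status of the printed hypothesis (primary texts read for this file).** BMM give all their results
as "conditional on the stabilization of the trace formula for the (disconnected) groups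
`GL(N) ⋊ ⟨θ⟩` associated to base change" (abstract), as does Mok for the endoscopic classification
of quasi-split unitary groups: "the results obtained in this paper is still conditional on the
stabilization of the twisted trace formula" [cite: Mok2014, §1], whose bibliography moreover lists
Arthur's *A non-tempered intertwining relation for `GL(N)`* and *Duality, Endoscopy and Hecke
operators* as "in preparation". That stabilisation is [cite: MoeglinWaldspurger2016, Vol. 1–2]; it
takes the twisted weighted fundamental lemma from Waldspurger, Math. Ann. 343 (2009), Thm. 3.8, of
which part II of the series says: "Ce théorème était conditionnel, mais les conditions imposées
sont levées par les résultats de Ngo Bao Chau et ceux de Chaudouard et Laumon, bien que ces derniers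
ne soient pas encore publiés en toute généralité" [cite: Waldspurger2014StabilisationII, §4.4];
and Chaudouard–Laumon print the weighted fundamental lemma for SPLIT groups only: "nous nous sommes
limités dans cet article au cas des groupes déployés. Le cas général, qui comprend aussi les formes
«non-standard» dues à Waldspurger du lemme fondamental pondéré, s'obtient par des méthodes
similaires et sera traité ultérieurement" [cite: ChaudouardLaumon2012, §1]. So the printed proof
chain behind the three named facts of `BallQuotientHodgeClasses` is complete up to that announced
general case of the weighted fundamental lemma (and Arthur's announced papers). The layer vendors
the facts unconditionally (module docstring of `BallQuotientHodgeClasses`, "Status of the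
results"); this file records the dependency and does not alter that decision.

## References

* [BergeronMillsonMoeglin2016Balls] N. Bergeron, J. Millson, C. Moeglin, *The Hodge conjecture and
  arithmetic quotients of complex balls*, Acta Math. 216 (2016) 1–125; arXiv:1306.1515v2:
  Introduction §1.2 Remark 3; Part 2 §§1.6–1.9 (Thm. 61, Cor. 62 and Remark).
* [MoeglinWaldspurger2016] C. Moeglin, J.-L. Waldspurger, *Stabilisation de la formule des traces
  tordue*, Vol. 1, 2, Progress in Math. 316–317 (2016).
* [Waldspurger2014StabilisationII] J.-L. Waldspurger, *Stabilisation de la formule des traces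
  tordue II: intégrales orbitales et endoscopie sur un corps local non-archimédien; définitions et
  énoncés des résultats*, arXiv:1401.7127 (2014): §4.4.
* [ChaudouardLaumon2012] P.-H. Chaudouard, G. Laumon, *Le lemme fondamental pondéré. II. Énoncés
  cohomologiques*, Ann. of Math. 176 (2012) 1647–1781 = arXiv:0912.4512: §1.
* [Mok2014] C. P. Mok, *Endoscopic classification of representations of quasi-split unitary
  groups*, Mem. Amer. Math. Soc. 235 (2015), no. 1108 = arXiv:1206.0882: §1 and bibliography.
* [VoisinHodgeI2002] C. Voisin, *Hodge Theory and Complex Algebraic Geometry I* (2002), Thm. 6.18,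
  §7.1.1.
-/

noncomputable section

namespace Literature.AlgebraicGeometry.ShimuraVarieties

open Literature.AlgebraicGeometry.Motives (SchemeOver IsSmoothProjective)
open Literature.AlgebraicGeometry.HodgeTheory

/-! ### Degree `≤ 1`: `H^{a,b} ⊔ H^{b,a}` is everything -/

/-- In a Hodge model `A` of `X` and a degree `k = a + b ≤ 1`, the two pieces `H^{a,b}` and `H^{b,a}`
exhaust `Hᵏ(X^an; ℂ)`: by the Hodge decomposition of the model
(`HodgeModel.isInternal_hodgePQ`) `Hᵏ_dR = ⨁_{i+j=k} H^{i,j}`, and for `k ≤ 1` the antidiagonal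
`{(i,j) | i + j = k}` is `{(a,b), (b,a)}`; transport along the de Rham comparison `A.deRham`.
[cite: VoisinHodgeI2002, Thm. 6.18] -/
theorem hodgePQ_sup_hodgePQ_eq_top_of_add_le_one {p : ℕ} {X : SchemeOver ℂ} (A : HodgeModel p X)
    {a b : ℕ} (hab : a + b ≤ 1) : A.hodgePQ (a + b) a b ⊔ A.hodgePQ (a + b) b a = ⊤ := by
  set e := A.deRham A.carrier (a + b) with he
  set T : ↥(Finset.antidiagonal (a + b)) →
      Submodule ℂ (Literature.NumberTheory.Transcendental.complexDeRhamCohomology A.model A.carrier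
        (a + b)) :=
    fun pq ↦ Literature.NumberTheory.Transcendental.hodgePQ A.model A.carrier (a + b) pq.1.1 pq.1.2
    with hT
  -- the Hodge decomposition of the model: the pieces span `Hᵏ_dR`
  have htop : iSup T = ⊤ := (A.isInternal_hodgePQ (a + b)).submodule_iSup_eq_top
  -- for `k ≤ 1` every piece is `H^{a,b}` or `H^{b,a}`
  have hle : iSup T ≤ Literature.NumberTheory.Transcendental.hodgePQ A.model A.carrier (a + b) a b ⊔
      Literature.NumberTheory.Transcendental.hodgePQ A.model A.carrier (a + b) b a := by
    refine iSup_le fun pq ↦ ?_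
    obtain ⟨⟨i, j⟩, hij⟩ := pq
    have hij' : i + j = a + b := Finset.mem_antidiagonal.1 hij
    change Literature.NumberTheory.Transcendental.hodgePQ A.model A.carrier (a + b) i j ≤ _
    rcases (show (i = a ∧ j = b) ∨ (i = b ∧ j = a) by omega) with ⟨rfl, rfl⟩ | ⟨rfl, rfl⟩
    · exact le_sup_left
    · exact le_sup_right
  -- transport along the comparison isomorphism `e : Hᵏ_dR(X^an; ℂ) ≃ Hᵏ(X^an; ℂ)`
  refine eq_top_iff.2 fun y _ ↦ ?_
  obtain ⟨x, rfl⟩ := e.surjective y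
  have hx : x ∈ iSup T := by rw [htop]; exact Submodule.mem_top
  change e x ∈
    (Literature.NumberTheory.Transcendental.hodgePQ A.model A.carrier (a + b) a b).map e.toLinearMap ⊔
      (Literature.NumberTheory.Transcendental.hodgePQ A.model A.carrier (a + b) b a).map e.toLinearMap
  rw [← Submodule.map_sup]
  exact Submodule.mem_map.2 ⟨x, hle hx, rfl⟩

/-! ### Cor. 62 in the degenerate range -/

/-- **Cor. 62 in degree `a + b ≤ 1` holds for every smooth projective `X`, with no hypothesis on the
class**: for `k = a + b ≤ 1` the condition "pull-back in `H^{a,b} ⊔ H^{b,a}`" is vacuous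
(`hodgePQ_sup_hodgePQ_eq_top_of_add_le_one`), so the assertion is that `Hᵏ(X(ℂ); ℂ)` is the
complex span of its rational classes — `Hᵏ(X(ℂ); ℚ) ⊗ ℂ = Hᵏ(X(ℂ); ℂ)` (Voisin I §7.1.1; the tree's
`span_isRationalClass_eq_top_of_isSmoothProjective_holds`). This is the only part of
`bmm2016_hodgePQ_definedOverQ` without automorphic content.
[cite: VoisinHodgeI2002, §7.1.1] [cite: BergeronMillsonMoeglin2016Balls, Part 2 §1.9 Cor. 62] -/
theorem bmm2016_hodgePQ_definedOverQ_of_add_le_one {p : ℕ} {X : SchemeOver ℂ}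
    (hX : IsSmoothProjective p X) {a b : ℕ} (hab : a + b ≤ 1) (A : HodgeModel p X)
    (x : complexBetti X (a + b)) :
    x ∈ Submodule.span ℂ {y : complexBetti X (a + b) |
      IsRationalClass y ∧ A.pullback (a + b) y ∈ A.hodgePQ (a + b) a b ⊔ A.hodgePQ (a + b) b a} := by
  have htop := hodgePQ_sup_hodgePQ_eq_top_of_add_le_one A hab
  have hsub : {y : complexBetti X (a + b) | IsRationalClass y} ⊆ {y : complexBetti X (a + b) |
      IsRationalClass y ∧ A.pullback (a + b) y ∈ A.hodgePQ (a + b) a b ⊔ A.hodgePQ (a + b) b a} := by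
    intro y hy
    refine ⟨hy, ?_⟩
    rw [htop]
    exact Submodule.mem_top
  exact Submodule.span_mono hsub
    (span_isRationalClass_eq_top_of_isSmoothProjective_holds.mem_span hX x)

/-- **Cor. 62 for ball quotients of dimension `p ≤ 2`** (the statement of
`bmm2016_hodgePQ_definedOverQ` with `p ≤ 2`): the range `3(a+b) + |a-b| < 2(p+1) ≤ 6` forces
`a + b ≤ 1`, where `bmm2016_hodgePQ_definedOverQ_of_add_le_one` applies. (The Remark after Cor. 62 —
for `p = 2`, `H^{1,1} ⊂ H²` is not defined over `ℚ`, Blasius–Rogawski — concerns `(a,b) = (1,1)`,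
`3·2 + 0 = 6 ≮ 6`, outside the range.)
[cite: BergeronMillsonMoeglin2016Balls, Part 2 §1.9 Cor. 62 and Remark] -/
theorem bmm2016_hodgePQ_definedOverQ_of_le_two :
    ∀ (p : ℕ) (X : SchemeOver ℂ), p ≤ 2 → Nonempty (UnitaryBallQuotientDatum p X) →
      IsSmoothProjective p X →
      ∀ a b : ℕ, 3 * (a + b) + Nat.dist a b < 2 * (p + 1) →
        ∀ (A : HodgeModel p X) (x : complexBetti X (a + b)),
          A.pullback (a + b) x ∈ A.hodgePQ (a + b) a b ⊔ A.hodgePQ (a + b) b a →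
            x ∈ Submodule.span ℂ {y : complexBetti X (a + b) |
              IsRationalClass y ∧
                A.pullback (a + b) y ∈ A.hodgePQ (a + b) a b ⊔ A.hodgePQ (a + b) b a} := by
  intro p X hp _ hX a b hab A x _
  exact bmm2016_hodgePQ_definedOverQ_of_add_le_one hX (by omega) A x

/-- **Reduction of Cor. 62 to its genuine range.** `bmm2016_hodgePQ_definedOverQ` follows from its
instances with `3 ≤ p` and `2 ≤ a + b` (the first being `H^{1,1} ⊂ H²` of a ball quotient
threefold, BMM's Remark "`H^{1,1}` is defined over `ℚ` as long as `p > 2`"): the instances with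
`a + b ≤ 1` are `bmm2016_hodgePQ_definedOverQ_of_add_le_one`, and `2 ≤ a + b` with
`3(a+b) + |a-b| < 2(p+1)` forces `3 ≤ p`. These remaining instances are BMM's theorem proper
(Thm. 61: Matsushima's formula, Vogan–Zuckerman, theta lifts and Arthur's endoscopic
classification), not available in the tree.
[cite: BergeronMillsonMoeglin2016Balls, Part 2 §1.9 Thm. 61, Cor. 62 and Remark] -/
theorem bmm2016_hodgePQ_definedOverQ_of_two_le
    (h : ∀ (p : ℕ) (X : SchemeOver ℂ), 3 ≤ p → Nonempty (UnitaryBallQuotientDatum p X) →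
      IsSmoothProjective p X →
      ∀ a b : ℕ, 2 ≤ a + b → 3 * (a + b) + Nat.dist a b < 2 * (p + 1) →
        ∀ (A : HodgeModel p X) (x : complexBetti X (a + b)),
          A.pullback (a + b) x ∈ A.hodgePQ (a + b) a b ⊔ A.hodgePQ (a + b) b a →
            x ∈ Submodule.span ℂ {y : complexBetti X (a + b) |
              IsRationalClass y ∧
                A.pullback (a + b) y ∈ A.hodgePQ (a + b) a b ⊔ A.hodgePQ (a + b) b a}) :
    bmm2016_hodgePQ_definedOverQ := by
  intro p X hD hX a b hab A x hx
  rcases Nat.lt_or_ge (a + b) 2 with hlt | hge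
  · exact bmm2016_hodgePQ_definedOverQ_of_add_le_one hX (by omega) A x
  · exact h p X (by omega) hD hX a b hge hab A x hx

/-- **The residual content of Cor. 62, exactly.** `bmm2016_hodgePQ_definedOverQ` is EQUIVALENT to
its instances with `3 ≤ p` and `2 ≤ a + b` (`bmm2016_hodgePQ_definedOverQ_of_two_le` and
specialisation): what remains to be proved of the named fact is precisely BMM's theorem for ball
quotients of dimension `≥ 3` in degrees `≥ 2`.
[cite: BergeronMillsonMoeglin2016Balls, Part 2 §1.9 Cor. 62 and Remark] -/
theorem bmm2016_hodgePQ_definedOverQ_iff_two_le :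
    bmm2016_hodgePQ_definedOverQ ↔
      ∀ (p : ℕ) (X : SchemeOver ℂ), 3 ≤ p → Nonempty (UnitaryBallQuotientDatum p X) →
        IsSmoothProjective p X →
        ∀ a b : ℕ, 2 ≤ a + b → 3 * (a + b) + Nat.dist a b < 2 * (p + 1) →
          ∀ (A : HodgeModel p X) (x : complexBetti X (a + b)),
            A.pullback (a + b) x ∈ A.hodgePQ (a + b) a b ⊔ A.hodgePQ (a + b) b a →
              x ∈ Submodule.span ℂ {y : complexBetti X (a + b) |
                IsRationalClass y ∧
                  A.pullback (a + b) y ∈ A.hodgePQ (a + b) a b ⊔ A.hodgePQ (a + b) b a} :=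
  ⟨fun h p X _ hD hX a b _ hab A x hx ↦ h p X hD hX a b hab A x hx,
    bmm2016_hodgePQ_definedOverQ_of_two_le⟩

/-! ### With Lefschetz `(1,1)`: for `p > 2` all of `H^{1,1}` is spanned by divisor classes -/

/-- **Cor. 62 and Lefschetz' theorem on `(1,1)`-classes give `H^{1,1}(S, ℂ) = NS(S) ⊗ ℂ` for
compact ball quotients of dimension `p > 2`.** By the Remark after Cor. 62, `H^{1,1} ⊂ H²(S, ℂ)` is
defined over `ℚ` for `p > 2` (`bmm2016_hodgePQ_definedOverQ.mem_span_rational_oneOne`: every class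
of Hodge type `(1,1)` is a `ℂ`-linear combination of RATIONAL `(1,1)`-classes), and rational
`(1,1)`-classes are classes of divisors (Lefschetz, Voisin I Thm. 11.30; the tree's named fact
`lefschetzOneOne_rational`); hence every class of Hodge type `(1,1)` in `H²(X(ℂ); ℂ)` lies in
`algebraicClasses X 1 = N¹ H²(X(ℂ); ℂ)`, the complex span of the divisor classes (the inclusion
proved here; with the classical converse "divisor classes are of type `(1,1)`", Voisin I
Prop. 11.20, this is `H^{1,1} = NS ⊗ ℂ`, "`ρ = h^{1,1}`"). False for `p = 2` (Blasius–Rogawski,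
loc. cit.). Conditional on the two named facts.
[cite: BergeronMillsonMoeglin2016Balls, Part 2 §1.9 Remark after Cor. 62]
[cite: VoisinHodgeI2002, Thm. 11.30 and §11.3.3] -/
theorem bmm2016_hodgePQ_definedOverQ.hodgeOneOne_mem_algebraicClasses
    (h : bmm2016_hodgePQ_definedOverQ) (hL : lefschetzOneOne_rational) {p : ℕ} {X : SchemeOver ℂ}
    (hD : Nonempty (UnitaryBallQuotientDatum p X)) (hX : IsSmoothProjective p X) (hp : 2 < p)
    (x : complexBetti X (1 + 1)) (hx : IsOfHodgeType p X (1 + 1) 1 1 x) :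
    x ∈ algebraicClasses X 1 := by
  have hspan := h.mem_span_rational_oneOne hD hX hp x hx
  have hle : Submodule.span ℂ {y : complexBetti X (1 + 1) |
      IsRationalClass y ∧ IsOfHodgeType p X (1 + 1) 1 1 y} ≤ algebraicClasses X 1 :=
    Submodule.span_le.2 fun y hy ↦ hL hX y hy.1 hy.2
  exact hle hspan

/-! ### The diagonal case in the layer's `∃`-over-models spelling -/

/-- **Cor. 62, diagonal case, with `IsOfHodgeType`**: for `6n < 2(p+1)` every class of Hodge type
`(n,n)` on a compact ball quotient (`IsOfHodgeType p X (n+n) n n`, `∃` over Hodge models) is a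
`ℂ`-linear combination of RATIONAL classes of Hodge type `(n,n)` — the general-`n` form of
`bmm2016_hodgePQ_definedOverQ.mem_span_rational_oneOne`.
[cite: BergeronMillsonMoeglin2016Balls, Part 2 §1.9 Cor. 62] -/
theorem bmm2016_hodgePQ_definedOverQ.mem_span_rational_nn (h : bmm2016_hodgePQ_definedOverQ)
    {p : ℕ} {X : SchemeOver ℂ} (hD : Nonempty (UnitaryBallQuotientDatum p X))
    (hX : IsSmoothProjective p X) {n : ℕ} (hn : 3 * (n + n) < 2 * (p + 1))
    (x : complexBetti X (n + n)) (hx : IsOfHodgeType p X (n + n) n n x) :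
    x ∈ Submodule.span ℂ {y : complexBetti X (n + n) |
      IsRationalClass y ∧ IsOfHodgeType p X (n + n) n n y} := by
  obtain ⟨A, hA⟩ := hx
  refine Submodule.span_mono (fun y hy ↦ ?_) (h.diagonal hD hX hn A x hA)
  exact ⟨hy.1, A, hy.2⟩

/-! ### With Cor. 2 / Thm. 1: the whole complex pieces are algebraic / of level `≥ min(a,b)` -/

/-- **Cor. 62 with Cor. 2: for `3n ≤ p`, ALL of `H^{n,n}(S, ℂ)` consists of combinations of
algebraic cycle classes.** For a compact ball quotient of dimension `p` and `3n ≤ p` (so that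
`3(n+n) + 0 < 2(p+1)`), the diagonal case of Cor. 62 says `H^{n,n} ⊂ H²ⁿ(S, ℂ)` is spanned by its
rational classes (`bmm2016_hodgePQ_definedOverQ.diagonal`), and Cor. 2 (lower third,
`bmm2016_hodge_offMiddleThird.lowerThird`) says those are algebraic; hence every class of Hodge type
`(n,n)` in `H²ⁿ(X(ℂ); ℂ)` lies in `algebraicClasses X n = Nⁿ H²ⁿ(X(ℂ); ℂ)` — the case `n = 1` being
`hodgeOneOne_mem_algebraicClasses` (there via Lefschetz). Conditional on the two named facts.
[cite: BergeronMillsonMoeglin2016Balls, Part 2 §1.9 Cor. 62 and §1.3 Cor. 2] -/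
theorem bmm2016_hodgePQ_definedOverQ.hodgeTypeNN_mem_algebraicClasses
    (h : bmm2016_hodgePQ_definedOverQ) (h₂ : bmm2016_hodge_offMiddleThird) {p : ℕ}
    {X : SchemeOver ℂ} (hD : Nonempty (UnitaryBallQuotientDatum p X)) (hX : IsSmoothProjective p X)
    {n : ℕ} (hn : 3 * n ≤ p) (x : complexBetti X (2 * n)) (hx : IsOfHodgeType p X (2 * n) n n x) :
    x ∈ algebraicClasses X n := by
  obtain ⟨A, hA⟩ := hx
  -- Cor. 62 (diagonal case), transported from degree `n + n` to degree `2 * n`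
  have key : ∀ k : ℕ, k = n + n → ∀ (B : HodgeModel p X) (z : complexBetti X k),
      B.pullback k z ∈ B.hodgePQ k n n →
        z ∈ Submodule.span ℂ {y : complexBetti X k |
          IsRationalClass y ∧ B.pullback k y ∈ B.hodgePQ k n n} := by
    rintro k rfl B z hz
    exact h.diagonal hD hX (by omega) B z hz
  refine (Submodule.span_le.2 ?_) (key (2 * n) (two_mul n) A x hA)
  rintro y ⟨hy, hyA⟩
  exact h₂.lowerThird hD hX hn y hy ⟨A, hyA⟩

/-- **… and in the upper third by hard Lefschetz**: on a compact ball quotient of dimension `p`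
carrying a hard Lefschetz datum `Λ` (`HardLefschetzNFold p X`), for `3n ≤ p ∨ 2p ≤ 3n` every class of
Hodge type `(n,n)` in `H²ⁿ(X(ℂ); ℂ)` lies in `algebraicClasses X n`. Upper third, `p < 2n`: a class
`c` of type `(n,n)` is `L^{2n-p} c'` (`Λ.bijective_L`) with `c'` of type `(p-n, p-n)`
(`Λ.isOfHodgeType_L_iff`), `c'` lies in the lower third (`3(p-n) ≤ p ↔ 2p ≤ 3n`) and so is a
combination of algebraic classes (`hodgeTypeNN_mem_algebraicClasses`), and `L^{2n-p}` preserves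
algebraic classes (`Λ.L_mem_algebraicClasses_of_mem`) — BMM §1.2: "`NᶜH•(S, ℚ)` is stable under
duality (the isomorphism given by the Hard Lefschetz Theorem)"; for `n > p` there are no non-zero
`(n,n)`-classes (`IsOfHodgeType.eq_zero_pp_of_lt`). Conditional on the two named facts (and the
datum `Λ`, an instance of the tree's fact `nonempty_hardLefschetzNFold`).
[cite: BergeronMillsonMoeglin2016Balls, §1.2, §1.3 Cor. 2 and Part 2 §1.9 Cor. 62]
[cite: VoisinHodgeI2002, Thm. 6.25, Rem. 6.27 and §7.1.2] -/
theorem bmm2016_hodgePQ_definedOverQ.hodgeTypeNN_mem_algebraicClasses_of_hardLefschetz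
    (h : bmm2016_hodgePQ_definedOverQ) (h₂ : bmm2016_hodge_offMiddleThird) {p : ℕ}
    {X : SchemeOver ℂ} (hD : Nonempty (UnitaryBallQuotientDatum p X)) (hX : IsSmoothProjective p X)
    (Λ : HardLefschetzNFold p X) {n : ℕ} (hrange : 3 * n ≤ p ∨ 2 * p ≤ 3 * n)
    (x : complexBetti X (2 * n)) (hx : IsOfHodgeType p X (2 * n) n n x) :
    x ∈ algebraicClasses X n := by
  -- index form of the hard-Lefschetz transport (no subtraction): `2l + j = p`, `l + j = n`
  have index : ∀ l j : ℕ, 2 * l + j = p → l + j = n → 3 * l ≤ p → x ∈ algebraicClasses X n := by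
    rintro l j hlj rfl h3l
    obtain ⟨c', rfl⟩ := (Λ.bijective_L hlj (2 * (l + j)) (by omega)).2 x
    have hc' : IsOfHodgeType p X (2 * l) l l c' :=
      (Λ.isOfHodgeType_L_iff hlj (2 * (l + j)) (by omega) l l c').1 hx
    exact Λ.L_mem_algebraicClasses_of_mem j l (by omega)
      (h.hodgeTypeNN_mem_algebraicClasses h₂ hD hX h3l c' hc')
  rcases hrange with h3 | h3
  · exact h.hodgeTypeNN_mem_algebraicClasses h₂ hD hX h3 x hx
  · by_cases hnp : n ≤ p
    · rcases Nat.lt_or_ge p (2 * n) with hlt | hle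
      · exact index (p - n) (2 * n - p) (by omega) (by omega) (by omega)
      · exact h.hodgeTypeNN_mem_algebraicClasses h₂ hD hX (by omega) x hx
    · rw [hx.eq_zero_pp_of_lt (by omega)]
      exact Submodule.zero_mem _

/-- **Cor. 62 with Thm. 1: the whole complex piece `H^{a,b} ⊕ H^{b,a}` is of level `≥ min(a,b)`.**
In the range `3(a+b) + |a-b| < 2(p+1)` one has `2(a+b) < p + 1 + min(a,b)` (for `a ≥ b`:
`4a + 2b < 2p + 2` gives `2a + b < p + 1`), so Thm. 1 (`bmm2016_generalizedHodge_lowDegree`) applies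
in degree `a + b` with `c = min(a,b)`; the piece is spanned by its rational classes (Cor. 62), each
of which lies in `⊕_{a'+b'=a+b, a',b' ≥ c} H^{a',b'}` (`HodgeModel.hodgePQ_le_hodgeConiveau`) and
hence, by Thm. 1, in `Nᶜ H^{a+b}`; so EVERY class of `H^{a+b}(X(ℂ); ℂ)` whose image in a Hodge
model lies in `H^{a,b} ⊔ H^{b,a}` lies in `supportedClasses X (a+b) (min a b) = Nᶜ H^{a+b}(X(ℂ); ℂ)`
— §1.2 Remark 3 ("every rational cohomology class in that subspace is a linear combination with
rational coefficients of … pushforwards … from … special cycles"), here for all complex classes of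
the piece, in the tree's support language. Conditional on the two named facts.
[cite: BergeronMillsonMoeglin2016Balls, §1.2 Thm. 1 and Remark 3; Part 2 §1.9 Cor. 62] -/
theorem bmm2016_hodgePQ_definedOverQ.mem_supportedClasses_min
    (h : bmm2016_hodgePQ_definedOverQ) (h₁ : bmm2016_generalizedHodge_lowDegree) {p : ℕ}
    {X : SchemeOver ℂ} (hD : Nonempty (UnitaryBallQuotientDatum p X)) (hX : IsSmoothProjective p X)
    {a b : ℕ} (hab : 3 * (a + b) + Nat.dist a b < 2 * (p + 1)) (A : HodgeModel p X)
    (x : complexBetti X (a + b))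
    (hx : A.pullback (a + b) x ∈ A.hodgePQ (a + b) a b ⊔ A.hodgePQ (a + b) b a) :
    x ∈ supportedClasses X (a + b) (min a b) := by
  -- the range of Cor. 62 implies the range of Thm. 1 with `c = min a b`
  have hrange : 2 * (a + b) < p + 1 + min a b := by
    rcases le_total a b with hle | hle
    · have hd : Nat.dist a b = b - a := Nat.dist_eq_sub_of_le hle
      have hm : min a b = a := min_eq_left hle
      omega
    · have hd : Nat.dist a b = a - b := Nat.dist_eq_sub_of_le_right hle
      have hm : min a b = b := min_eq_right hle
      omega
  -- `H^{a,b} ⊔ H^{b,a}` lies in the Hodge-coniveau-`≥ min a b` part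
  have hcon : A.hodgePQ (a + b) a b ⊔ A.hodgePQ (a + b) b a ≤ A.hodgeConiveau (a + b) (min a b) :=
    sup_le (A.hodgePQ_le_hodgeConiveau rfl (min_le_left a b) (min_le_right a b))
      (A.hodgePQ_le_hodgeConiveau (add_comm b a) (min_le_right a b) (min_le_left a b))
  refine (Submodule.span_le.2 ?_) (h p X hD hX a b hab A x hx)
  rintro y ⟨hy, hyA⟩
  exact h₁.mem_supportedClasses hD hX hrange A y hy (hcon hyA)

end Literature.AlgebraicGeometry.ShimuraVarieties

end
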